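import Summits.NavierStokesRegularity.FluidComputer.LambdaFrontier

/-!
# Fluid computer — the Λ LOG-CEILING under an analytic envelope (rung R2, idea-2 card O10; pub-fluidc-lit gen 37)

HONEST FRAMING (cell `pub-fluidc`, verbatim): *low prior, high value-of-information experiment on Tao's
machine paradigm; NOT a claim that NS blows up.* Theorem side of the cell; nothing here is evidence of
blow-up.

Card O10 of the negation seat (idea-2, "Λ log-ceiling", pre-registration ADDENDUM C 2026-08-23T06:03Z,
`pub-fluidc-idea-2/CARD-O10-lambda-ceiling.md`) reads the amplitude rung through the Cheskidov–Shvydkoy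
DISSIPATION WAVENUMBER `Λ_{c₀,ν}` (tree: `Literature.Analysis.FluidPDE.dissipationWavenumber`,
arXiv:1102.1944 §3): *inside the Euler twin's analytic window a ν-uniform analytic (Gevrey-1) envelope on
the dyadic block amplitudes, `‖Δ̇_j u^ν(t)‖_∞ ≤ M e^{-τ(t) 2^j}`, caps the frontier at
`Λ ≤ log (M/(c₀ν)) / τ(t)` — `O(log Re)` wavenumbers, `O(log log Re)` dyadic LEVELS — so an unbounded
ladder (`LambdaFrontier.iSup_dissipationWavenumber_eq_top`) must be paid for by the analyticity radius
collapsing, never by the Reynolds number.* The printed backbone of the HYPOTHESIS (not formalised here;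
the envelope is an explicit assumption of every theorem below) is the ν-uniform Gevrey-class theory of
the vanishing-viscosity limit on `𝕋³`: Cheng–Li–Xu, Math. Meth. Appl. Sci. (2017) = arXiv:1702.06738,
Thm 1.1 + Rem 1.1 (for Gevrey data `a ∈ 𝒢^s_{r,τ₀}`, `r > 9/2`, `s ≥ 1`: a radius `τ(t) > 0`, decreasing,
UNIFORM in `0 < ν ≤ ν₀` on every `[0,T]`, `T < T_*` the `ℋ^r` lifespan, with
`u^ν ∈ L^∞([0,T]; 𝒢^s_{r,τ(·)})` and `‖u^ν(t) - u(t)‖_{𝒢^s_{r-1,τ(t)}} ≤ C√ν`), and Kukavica–Vicol,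
Proc. AMS 137 (2009) 669–677 (the Euler analyticity radius). The tree's blocks live on `ℝ³`, the printed
theorem on `𝕋³`; the dictionary "Gevrey-1 norm bound ⇒ block envelope `M e^{-τ 2^j}` (polynomial
prefactors absorbed into a slightly smaller `τ`)" is informal and is NOT asserted here.

CONTENTS (all proved, 0 sorry, no new definitions or named facts):

* §1 the real-variable core — idea-2's `SKETCH-R2-lambda-ceiling.lean` (sha16 845c8542b41edb76,
  2026-08-23T06:11Z) VERBATIM: `saturated_le_log` (`c₀νk ≤ a ≤ M e^{-τk}`, `k ≥ 1` ⇒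
  `k ≤ log(M/(c₀ν))/τ`), `not_saturated_above`, `ceiling_decade_shift` (ν ↦ ν/10 moves the ceiling by
  exactly `log 10/τ`), `ceiling_antitone_radius`;
* §2 the ceiling over the tree's `dissipationWavenumber`: a saturated level under the envelope has
  `2^j ≤ log(M/(c₀ν))/τ` (`two_pow_le_ceiling_of_saturated`) and `j ≤ log₂(log(M/(c₀ν))/τ)`
  (`level_le_logb_of_saturated` — the `O(log log Re)` level count); a slice whose blocks obey the envelope
  at every level has `Λ_{c₀,ν}(v) ≤ 1 ⊔ log(M/(c₀ν))/τ < ∞` (`dissipationWavenumber_le_ceiling`,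
  `dissipationWavenumber_lt_top_of_envelope`);
* §3 ceiling against frontier, for the cell's maximal smooth solutions with finite lifespan `T`, Leray–Hopf
  from `u 0` (thresholds below the Cheskidov–Shvydkoy constant are supplied internally): NO envelope with
  fixed `(M, τ)` survives on all of `(0,T)` — some slice before `T` has a block escaping it
  (`exists_slice_escaping_envelope`); and if the slices obey envelopes `M e^{-τ(t) 2^j}` with one constant
  `M`, then `inf_{t<T} τ(t) = 0` (`radius_not_bounded_below`) — card O10's "an unbounded ladder is paid for
  by the radius, never by Re", as a theorem about the would-be blow-up itself.

## References

* A. Cheskidov, R. Shvydkoy, J. Math. Fluid Mech. 16 (2014) 263–273 = arXiv:1102.1944, §3.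
  [CheskidovShvydkoy2011]
* A. Cheskidov, R. Shvydkoy, Arch. Ration. Mech. Anal. 195 (2010) 159–169, Lemma 3.2. [CheskidovShvydkoy2010]
* F. Cheng, W.-X. Li, C.-J. Xu, *Vanishing viscosity limit of Navier–Stokes equations in Gevrey class*,
  Math. Meth. Appl. Sci. (2017), doi:10.1002/mma.4378 = arXiv:1702.06738, Thm 1.1, Rem 1.1 (hypothesis
  backbone only).
* I. Kukavica, V. Vicol, *On the radius of analyticity of solutions to the three-dimensional Euler
  equations*, Proc. Amer. Math. Soc. 137 (2009) 669–677, doi:10.1090/S0002-9939-08-09693-7 (hypothesis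
  backbone only).
-/

noncomputable section

open MeasureTheory Set Function Filter Topology
open scoped ENNReal NNReal
open Literature.Analysis.FluidPDE Literature.Analysis.FunctionSpaces

namespace Summit.NavierStokesRegularity.FluidComputer.LambdaCeiling

/-! ## §1 Real-variable core (idea-2's sketch `SKETCH-R2-lambda-ceiling.lean`, sha16 845c8542b41edb76, verbatim) -/

/-- The log-ceiling: a saturated wavenumber under a uniform analytic envelope is at most
`log (M / (c₀ ν)) / τ`. -/
theorem saturated_le_log {M τ c₀ ν k a : ℝ} (hM : 0 < M) (hτ : 0 < τ) (hc : 0 < c₀) (hν : 0 < ν)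
    (hk : 1 ≤ k) (hbound : a ≤ M * Real.exp (-τ * k)) (hsat : c₀ * ν * k ≤ a) :
    k ≤ Real.log (M / (c₀ * ν)) / τ := by
  have hcν : 0 < c₀ * ν := mul_pos hc hν
  have h0 : c₀ * ν * 1 ≤ c₀ * ν * k := mul_le_mul_of_nonneg_left hk hcν.le
  have h1 : c₀ * ν ≤ M * Real.exp (-τ * k) := by linarith
  have h3 : Real.log (c₀ * ν) ≤ Real.log M + (-τ * k) := by
    have h := Real.log_le_log hcν h1
    rwa [Real.log_mul hM.ne' (Real.exp_pos _).ne', Real.log_exp] at h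
  have h4 : τ * k ≤ Real.log (M / (c₀ * ν)) := by
    rw [Real.log_div hM.ne' hcν.ne']
    linarith
  rw [le_div_iff₀ hτ]
  linarith [mul_comm k τ]

/-- Contrapositive reading: beyond the ceiling no wavenumber is saturated. -/
theorem not_saturated_above {M τ c₀ ν k a : ℝ} (hM : 0 < M) (hτ : 0 < τ) (hc : 0 < c₀) (hν : 0 < ν)
    (hk : 1 ≤ k) (hbound : a ≤ M * Real.exp (-τ * k))
    (habove : Real.log (M / (c₀ * ν)) / τ < k) : a < c₀ * ν * k := by
  by_contra h
  exact (not_le.mpr habove) (saturated_le_log hM hτ hc hν hk hbound (not_lt.mp h))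

/-- One decade of Reynolds number (ν ↦ ν / 10) raises the ceiling by exactly `log 10 / τ` shells:
the additive log law registered as P60 (the cell measured the algebraic-prefactor regime instead). -/
theorem ceiling_decade_shift {M τ c₀ ν : ℝ} (hM : 0 < M) (hc : 0 < c₀) (hν : 0 < ν) :
    Real.log (M / (c₀ * (ν / 10))) / τ = Real.log (M / (c₀ * ν)) / τ + Real.log 10 / τ := by
  have hcν : (c₀ * ν) ≠ 0 := (mul_pos hc hν).ne'
  have hq : 0 < M / (c₀ * ν) := div_pos hM (mul_pos hc hν)
  have e : M / (c₀ * (ν / 10)) = M / (c₀ * ν) * 10 := by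
    field_simp
  rw [e, Real.log_mul hq.ne' (by norm_num : (10 : ℝ) ≠ 0), add_div]

/-- The ceiling is monotone in the envelope constant and antitone in the radius: a wider analytic strip
(larger `τ`) lowers it. -/
theorem ceiling_antitone_radius {M c₀ ν τ₁ τ₂ : ℝ}
    (hlog : 0 ≤ Real.log (M / (c₀ * ν))) (hτ₁ : 0 < τ₁) (h12 : τ₁ ≤ τ₂) :
    Real.log (M / (c₀ * ν)) / τ₂ ≤ Real.log (M / (c₀ * ν)) / τ₁ := by
  exact div_le_div_of_nonneg_left hlog hτ₁ h12

/-! ## §2 The ceiling over the Cheskidov–Shvydkoy dissipation wavenumber -/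

section Typed

variable {E : Type*} [NormedAddCommGroup E] [InnerProductSpace ℝ E] [FiniteDimensional ℝ E]
  [MeasurableSpace E] [BorelSpace E]
variable {E' : Type*} [NormedAddCommGroup E'] [NormedSpace ℝ E']

/-- The extended-real dyadic weight `2^j` is the real one. -/
theorem two_pow_eq_ofReal (j : ℕ) : (2 : ℝ≥0∞) ^ j = ENNReal.ofReal ((2 : ℝ) ^ j) := by
  rw [ENNReal.ofReal_pow (by norm_num : (0 : ℝ) ≤ 2), ENNReal.ofReal_ofNat]

/-- A saturated level whose block obeys the analytic envelope: `c₀ ν 2^j ≤ M e^{-τ 2^j}` as a real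
inequality (the saturation `ofReal (c₀ν)·2^j ≤ ‖Δ̇_j v‖_∞` of `IsSaturatedLevel` chained with the envelope
`‖Δ̇_j v‖_∞ ≤ ofReal (M e^{-τ 2^j})`). -/
theorem real_le_envelope_of_saturated {c₀ ν M τ : ℝ} (hM : 0 < M) {v : E → E'} {j : ℕ}
    (hsat : IsSaturatedLevel c₀ ν v j)
    (henv : eLpNorm (blockFn (j : ℤ) v) ∞ volume ≤ ENNReal.ofReal (M * Real.exp (-τ * 2 ^ j))) :
    c₀ * ν * 2 ^ j ≤ M * Real.exp (-τ * 2 ^ j) := by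
  have h : ENNReal.ofReal (c₀ * ν) * 2 ^ j ≤ ENNReal.ofReal (M * Real.exp (-τ * 2 ^ j)) :=
    ((isSaturatedLevel_iff c₀ ν v j).1 hsat).trans henv
  rw [two_pow_eq_ofReal, ← ENNReal.ofReal_mul' (by positivity : (0 : ℝ) ≤ 2 ^ j)] at h
  exact (ENNReal.ofReal_le_ofReal_iff (by positivity)).1 h

/-- **The log-ceiling at one level.** If level `j` of the slice `v` is saturated at threshold `c₀`,
viscosity `ν` (`c₀, ν > 0`) and its block obeys the analytic envelope `‖Δ̇_j v‖_∞ ≤ M e^{-τ 2^j}`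
(`M, τ > 0`), then `2^j ≤ log (M/(c₀ν)) / τ`. -/
theorem two_pow_le_ceiling_of_saturated {c₀ ν M τ : ℝ} (hc : 0 < c₀) (hν : 0 < ν) (hM : 0 < M)
    (hτ : 0 < τ) {v : E → E'} {j : ℕ} (hsat : IsSaturatedLevel c₀ ν v j)
    (henv : eLpNorm (blockFn (j : ℤ) v) ∞ volume ≤ ENNReal.ofReal (M * Real.exp (-τ * 2 ^ j))) :
    (2 : ℝ) ^ j ≤ Real.log (M / (c₀ * ν)) / τ :=
  saturated_le_log hM hτ hc hν (one_le_pow₀ one_le_two) le_rfl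
    (real_le_envelope_of_saturated hM hsat henv)

/-- **`O(log log Re)` levels.** Under the same hypotheses the INDEX of a saturated level obeys
`j ≤ log₂ (log (M/(c₀ν)) / τ)`. -/
theorem level_le_logb_of_saturated {c₀ ν M τ : ℝ} (hc : 0 < c₀) (hν : 0 < ν) (hM : 0 < M)
    (hτ : 0 < τ) {v : E → E'} {j : ℕ} (hsat : IsSaturatedLevel c₀ ν v j)
    (henv : eLpNorm (blockFn (j : ℤ) v) ∞ volume ≤ ENNReal.ofReal (M * Real.exp (-τ * 2 ^ j))) :
    (j : ℝ) ≤ Real.logb 2 (Real.log (M / (c₀ * ν)) / τ) := by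
  have h := two_pow_le_ceiling_of_saturated hc hν hM hτ hsat henv
  have hpos : (0 : ℝ) < 2 ^ j := by positivity
  rw [Real.le_logb_iff_rpow_le one_lt_two (hpos.trans_le h), Real.rpow_natCast]
  exact h

/-- **The Λ log-ceiling.** If every dyadic block of the slice `v` obeys the analytic envelope
`‖Δ̇_j v‖_∞ ≤ M e^{-τ 2^j}` (`M, τ > 0`), then for all thresholds `c₀ > 0` and viscosities `ν > 0`
`Λ_{c₀,ν}(v) ≤ 1 ⊔ log (M/(c₀ν)) / τ`. -/
theorem dissipationWavenumber_le_ceiling {c₀ ν M τ : ℝ} (hc : 0 < c₀) (hν : 0 < ν) (hM : 0 < M)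
    (hτ : 0 < τ) {v : E → E'}
    (henv : ∀ j : ℕ, eLpNorm (blockFn (j : ℤ) v) ∞ volume ≤ ENNReal.ofReal (M * Real.exp (-τ * 2 ^ j))) :
    dissipationWavenumber c₀ ν v ≤ 1 ⊔ ENNReal.ofReal (Real.log (M / (c₀ * ν)) / τ) := by
  refine dissipationWavenumber_le le_sup_left fun j hj => ?_
  rw [two_pow_eq_ofReal]
  exact (ENNReal.ofReal_le_ofReal (two_pow_le_ceiling_of_saturated hc hν hM hτ hj (henv j))).trans
    le_sup_right

/-- In particular the frontier of such a slice is FINITE. -/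
theorem dissipationWavenumber_lt_top_of_envelope {c₀ ν M τ : ℝ} (hc : 0 < c₀) (hν : 0 < ν)
    (hM : 0 < M) (hτ : 0 < τ) {v : E → E'}
    (henv : ∀ j : ℕ, eLpNorm (blockFn (j : ℤ) v) ∞ volume ≤ ENNReal.ofReal (M * Real.exp (-τ * 2 ^ j))) :
    dissipationWavenumber c₀ ν v < ∞ :=
  (dissipationWavenumber_le_ceiling hc hν hM hτ henv).trans_lt
    (max_lt ENNReal.one_lt_top ENNReal.ofReal_lt_top)

/-- **Re only shifts the ceiling logarithmically.** With the blocks under one envelope `(M, τ)`, dividing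
the viscosity by ten raises the bound on `Λ` by exactly `log 10 / τ` (the real-variable
`ceiling_decade_shift` transported to `Λ`). -/
theorem dissipationWavenumber_le_ceiling_decade {c₀ ν M τ : ℝ} (hc : 0 < c₀) (hν : 0 < ν) (hM : 0 < M)
    (hτ : 0 < τ) {v : E → E'}
    (henv : ∀ j : ℕ, eLpNorm (blockFn (j : ℤ) v) ∞ volume ≤ ENNReal.ofReal (M * Real.exp (-τ * 2 ^ j))) :
    dissipationWavenumber c₀ (ν / 10) v ≤
      1 ⊔ ENNReal.ofReal (Real.log (M / (c₀ * ν)) / τ + Real.log 10 / τ) := by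
  rw [← ceiling_decade_shift hM hc hν]
  exact dissipationWavenumber_le_ceiling hc (by positivity) hM hτ henv

end Typed

/-! ## §3 Ceiling against frontier: before a blow-up the envelope cannot stay uniform -/

/-- **Some slice escapes every fixed analytic envelope.** There is an absolute `c > 0` (the
Cheskidov–Shvydkoy constant of `LevelReynoldsFloor`) such that for every `ν > 0`, `T > 0`, every maximal
smooth solution `(u, p)` of the unforced Navier–Stokes system on `ℝ³ × [0,T)` (no classical continuation
past `T`) which is Leray–Hopf from `u 0`, and every `M, τ > 0`, some slice `u(t)`, `t ∈ (0,T)`, has a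
dyadic block with `‖Δ̇_j u(t)‖_∞ > M e^{-τ 2^j}`: the frontier is unbounded
(`LambdaFrontier.iSup_dissipationWavenumber_eq_top`) while the envelope would cap it
(`dissipationWavenumber_le_ceiling`). -/
theorem exists_slice_escaping_envelope :
    ∃ c : ℝ, 0 < c ∧ ∀ (ν T : ℝ), 0 < ν → 0 < T →
      ∀ (u : ℝ → EuclideanSpace ℝ (Fin 3) → EuclideanSpace ℝ (Fin 3))
        (p : ℝ → EuclideanSpace ℝ (Fin 3) → ℝ),
      IsMaximalSmoothSolution ν 0 u p T → IsLerayHopfOn T ν 0 (u 0) u →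
      ∀ M τ : ℝ, 0 < M → 0 < τ →
        ∃ t ∈ Ioo 0 T, ∃ j : ℕ,
          ENNReal.ofReal (M * Real.exp (-τ * 2 ^ j)) < eLpNorm (blockFn (j : ℤ) (u t)) ∞ volume := by
  obtain ⟨c, hc, H⟩ := LambdaFrontier.iSup_dissipationWavenumber_eq_top
  refine ⟨c, hc, fun ν T hν hT u p hmax hLH M τ hM hτ => ?_⟩
  by_contra hcon
  push Not at hcon
  have htop := H ν T hν hT u p hmax hLH (c / 2) (by linarith)
  have hle : ⨆ t ∈ Ioo 0 T, dissipationWavenumber (c / 2) ν (u t) ≤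
      1 ⊔ ENNReal.ofReal (Real.log (M / (c / 2 * ν)) / τ) :=
    iSup₂_le fun t ht => dissipationWavenumber_le_ceiling (by positivity) hν hM hτ (hcon t ht)
  exact (hle.trans_lt (max_lt ENNReal.one_lt_top ENNReal.ofReal_lt_top)).ne htop

/-- **The radius must collapse (card O10: "an unbounded ladder is paid for by the radius, never by
Re").** Same setting; if the slices obey analytic envelopes `‖Δ̇_j u(t)‖_∞ ≤ M e^{-τ(t) 2^j}` for all
`t ∈ (0,T)` and all levels `j`, with ONE constant `M > 0` and any radius function `τ`, then `τ` is not
bounded below on `(0,T)` by any positive number: `∀ τ₀ > 0, ∃ t ∈ (0,T), τ(t) < τ₀`. -/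
theorem radius_not_bounded_below :
    ∃ c : ℝ, 0 < c ∧ ∀ (ν T : ℝ), 0 < ν → 0 < T →
      ∀ (u : ℝ → EuclideanSpace ℝ (Fin 3) → EuclideanSpace ℝ (Fin 3))
        (p : ℝ → EuclideanSpace ℝ (Fin 3) → ℝ),
      IsMaximalSmoothSolution ν 0 u p T → IsLerayHopfOn T ν 0 (u 0) u →
      ∀ (M : ℝ) (τ : ℝ → ℝ), 0 < M →
        (∀ t ∈ Ioo 0 T, ∀ j : ℕ,
          eLpNorm (blockFn (j : ℤ) (u t)) ∞ volume ≤ ENNReal.ofReal (M * Real.exp (-τ t * 2 ^ j))) →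
        ∀ τ₀ : ℝ, 0 < τ₀ → ∃ t ∈ Ioo 0 T, τ t < τ₀ := by
  obtain ⟨c, hc, H⟩ := exists_slice_escaping_envelope
  refine ⟨c, hc, fun ν T hν hT u p hmax hLH M τ hM henv τ₀ hτ₀ => ?_⟩
  by_contra hcon
  push Not at hcon
  obtain ⟨t, ht, j, hj⟩ := H ν T hν hT u p hmax hLH M τ₀ hM hτ₀
  have hmono : M * Real.exp (-τ t * 2 ^ j) ≤ M * Real.exp (-τ₀ * 2 ^ j) := by
    refine mul_le_mul_of_nonneg_left (Real.exp_le_exp.2 ?_) hM.le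
    have h2 : (0 : ℝ) < 2 ^ j := by positivity
    nlinarith [hcon t ht]
  exact (not_le.2 hj) ((henv t ht j).trans (ENNReal.ofReal_le_ofReal hmono))

end Summit.NavierStokesRegularity.FluidComputer.LambdaCeiling

end
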